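import Summits.Ventures.HSemireg.EmbeddedFirstOrderDeformationsRestriction
import Summits.Ventures.HSemireg.EmbeddedFirstOrderDeformationsSmoothSplitting

/-!
# Venture HSemireg — the transition derivations of a locally split thickened atlas form a ČECH 1-COCYCLE of the
# tangent presheaf whose class does not depend on the local sections («`(θ_αβ) ↦ ξ ∈ H¹(X, T_X)`», Čech level), and
# its image under `D ↦ D̄|_I` restricts like the obstruction cochain

HONEST FRAMING.  Lean side of the computation cell `pub-hsemireg` (track «S4-PUSH» (ii), seat s4-prove-3 g5, second
route for (S5)); log `s4push/prove-3/ATTEMPT-9.md` (file IV).  Plain commutative algebra: flat first-order thickenings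
with ring SECTIONS and morphisms of thickenings carrying sections to sections (`…Restriction`: `IsThickeningHom`;
`…SmoothSplitting`: `transitionDerivation θ(σ, σ')`, `e·σ(θ a) = σ' a − σ a`).  No Mathlib scheme, sheaf, Čech-to-derived
comparison, abelian variety or semiregularity map is constructed; nothing here says that HC, HC_CM or HC_AV holds; no
object is certified; no Literature fact is declared.

WHY.  The (S5)/(H-arr) texts and this lineage's headers keep «the identification `(θ_αβ) ↔ ξ ∈ H¹(X, T_X)`» as prose:
for `X` nonsingular, a first-order deformation `X_ξ` is locally trivial, the transition automorphisms are
`ψ_αβ = id + εθ_αβ`, `(θ_αβ)` is a Čech 1-cocycle of `T_X` whose class `ξ` classifies `X_ξ` (Hartshorne Thm. 5.3 /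
Ex. 5.2 sketch), and the obstruction to keeping `Z ⊂ X` is the image of `ξ|_Z` in `H¹(Z, 𝒩)` (`…CechObstructionSplit`:
the cochain IS `θ̄_αβ|_{I_αβ}`).  THIS FILE proves the cocycle-level half of that identification
(namespace `Summit.Ventures.HSemireg.EmbeddedDeformation`):
* **`transitionDerivation_naturality`** — along a morphism of thickenings `ρ` over `r` carrying the sections `σ₁, σ₂`
  to sections `σ₁', σ₂'` (`ρσᵢ = σᵢ'r`): `r(θ(σ₁,σ₂) a) = θ(σ₁',σ₂')(r a)` — the transition derivation RESTRICTS
  (so the chart-overlap-triple-overlap restrictions of the `θ`'s are the `θ`'s of the restricted sections);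
* **`transitionDerivation_cech_cocycle`** — on a triple overlap carrying the three restricted chart sections,
  `θ_αγ = θ_αβ + θ_βγ` (`…SmoothSplitting`, `transitionDerivation_cocycle`), packaged with naturality: the family
  `(θ_αβ)` is a ČECH 1-COCYCLE of the tangent presheaf `U ↦ Der(𝒪(U))`;
* **`transitionDerivation_change_sections`** — replacing the chart sections `σ_α` by `σ'_α` (restricted: `σˡ ↦ σ'ˡ`,
  `σʳ ↦ σ'ʳ`) changes `θ_αβ = θ(σˡ, σʳ)` by a COBOUNDARY: `θ(σ'ˡ, σ'ʳ) = θ(σˡ, σʳ) + θ(σʳ, σ'ʳ) − θ(σˡ, σ'ˡ)`, and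
  `θ(σˡ, σ'ˡ)` is the restriction of `η_α := θ(σ_α, σ'_α)` (naturality) — the class `[θ] ∈ Ȟ¹(𝔘, T)` is well defined;
* **`resNormal_derivToNormal`** — `D ↦ D̄|_I` commutes with restriction: for `r`-related derivations
  (`r ∘ D = D' ∘ r`), `(D̄|_I)| = D̄'|_{I'}` (`…Restriction`, `resNormal`); hence the obstruction cochain `θ̄_αβ|_{I_αβ}`
  of `…CechObstructionSplit` is the image of the Kodaira–Spencer cocycle under `T → 𝒩`, cochain by cochain.
NOT typed: that every thickened atlas with isomorphic charts arises from a cocycle (essential surjectivity), Čech vs.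
sheaf `H¹(X, T_X)`, refinement.

References: R. Hartshorne, *Deformation Theory*, GTM 257 (2010), §5 (Thm. 5.3, Ex. 5.2: infinitesimal deformations of
a nonsingular `X` ↔ `H¹(X, T_X)` via the transition automorphisms of local trivialisations), §6 proof of Thm. 6.2
[corpus: book:springernd-deformation-theory p0047–p0049, p0056].
-/

namespace Summit.Ventures.HSemireg

namespace EmbeddedDeformation

universe u u' u''

section Naturality

variable {R' R : Type u} {S' S : Type u'} [CommRing R'] [CommRing R] [CommRing S'] [CommRing S]
variable {π : R' →+* R} {e : R'} {τ : S' →+* S} {e' : S'} {ρ : R' →+* S'} {r : R →+* S}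

/-- **The transition derivation restricts.**  If a morphism of thickenings `ρ` over `r` carries the sections `σ₁, σ₂`
of `π` to the sections `σ₁', σ₂'` of `τ` (`ρ ∘ σᵢ = σᵢ' ∘ r`), then `r (θ(σ₁, σ₂) a) = θ(σ₁', σ₂') (r a)`: apply `ρ`
to `e·σ₁(θ a) = σ₂ a − σ₁ a` and cancel `e'·σ₁'(·)`. [cite: Hartshorne2010, §5 Ex. 5.2 / §6 proof of Thm. 6.2] -/
theorem transitionDerivation_naturality (hT : IsFirstOrderThickening π e) (hT' : IsFirstOrderThickening τ e')
    (hρ : IsThickeningHom π e τ e' ρ r) (σ₁ σ₂ : R →+* R') (hσ₁ : ∀ a, π (σ₁ a) = a) (hσ₂ : ∀ a, π (σ₂ a) = a)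
    (σ₁' σ₂' : S →+* S') (hσ₁' : ∀ a, τ (σ₁' a) = a) (hσ₂' : ∀ a, τ (σ₂' a) = a)
    (c₁ : ρ.comp σ₁ = σ₁'.comp r) (c₂ : ρ.comp σ₂ = σ₂'.comp r) (a : R) :
    r (hT.transitionDerivation σ₁ σ₂ hσ₁ hσ₂ a) = hT'.transitionDerivation σ₁' σ₂' hσ₁' hσ₂' (r a) := by
  rw [← sub_eq_zero]
  refine hT'.eq_zero_of_eps_mul_section σ₁' hσ₁' ?_
  have h₁ : ∀ x, σ₁' (r x) = ρ (σ₁ x) := fun x ↦ by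
    rw [← RingHom.comp_apply, ← c₁, RingHom.comp_apply]
  have h₂ : ∀ x, σ₂' (r x) = ρ (σ₂ x) := fun x ↦ by
    rw [← RingHom.comp_apply, ← c₂, RingHom.comp_apply]
  rw [map_sub, mul_sub, hT'.eps_mul_section_transitionDerivation σ₁' σ₂' hσ₁' hσ₂', h₁, h₁, h₂, ← hρ.map_eps,
    ← map_mul, hT.eps_mul_section_transitionDerivation σ₁ σ₂ hσ₁ hσ₂, map_sub, sub_self]

/-- The same, as an identity of maps `R → S`: `r ∘ θ(σ₁,σ₂) = θ(σ₁',σ₂') ∘ r` (the derivations are `r`-RELATED).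
[cite: Hartshorne2010, §5 Ex. 5.2] -/
theorem transitionDerivation_naturality' (hT : IsFirstOrderThickening π e) (hT' : IsFirstOrderThickening τ e')
    (hρ : IsThickeningHom π e τ e' ρ r) (σ₁ σ₂ : R →+* R') (hσ₁ : ∀ a, π (σ₁ a) = a) (hσ₂ : ∀ a, π (σ₂ a) = a)
    (σ₁' σ₂' : S →+* S') (hσ₁' : ∀ a, τ (σ₁' a) = a) (hσ₂' : ∀ a, τ (σ₂' a) = a)
    (c₁ : ρ.comp σ₁ = σ₁'.comp r) (c₂ : ρ.comp σ₂ = σ₂'.comp r) :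
    (r : R → S) ∘ (hT.transitionDerivation σ₁ σ₂ hσ₁ hσ₂) =
      (hT'.transitionDerivation σ₁' σ₂' hσ₁' hσ₂') ∘ (r : R → S) :=
  funext fun a ↦ transitionDerivation_naturality hT hT' hρ σ₁ σ₂ hσ₁ hσ₂ σ₁' σ₂' hσ₁' hσ₂' c₁ c₂ a

/-! ### `D ↦ D̄|_I` commutes with restriction -/

variable {I : Ideal R} {I' : Ideal S} {K₀ : Ideal R'}

/-- **`(D̄|_I)| = D̄'|_{I'}` for `r`-related derivations** (`r ∘ D = D' ∘ r`): the restriction of normal vectors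
(`…Restriction`, `resNormal`) carries the class of `D` to the class of `D'`.  With `transitionDerivation_naturality`:
the obstruction cochain `θ̄_αβ|_{I_αβ}` restricts to triple overlaps as the `θ`'s do — it is the image of the
Kodaira–Spencer cocycle under `T → 𝒩`, cochain by cochain. [cite: Hartshorne2010, §6 proof of Thm. 6.2] -/
theorem resNormal_derivToNormal {B : Type u''} [CommRing B] [Algebra B R] [Algebra B S]
    (hT : IsFirstOrderThickening π e) (hT' : IsFirstOrderThickening τ e')
    (hρ : IsThickeningHom π e τ e' ρ r) (hP : PreservesLifts π e τ e' ρ I I') (h₀ : IsLift π e I K₀)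
    (D : Derivation B R R) (D' : Derivation B S S) (hD : ∀ x, r (D x) = D' (r x)) :
    resNormal hT hT' hP h₀ (derivToNormal I D) = derivToNormal I' D' :=
  (eq_resNormal hρ hP h₀ (derivToNormal I D) fun x y hy hx ↦ by
    rw [derivToNormal_apply, Ideal.Quotient.eq] at hy
    rw [derivToNormal_apply, eq_comm, Ideal.Quotient.eq, Subtype.coe_mk, ← hD, ← map_sub, ← hP.map_eq hρ h₀]
    exact Ideal.mem_map_of_mem r hy).symm

end Naturality

/-! ### The Čech 1-cocycle of transition derivations and its class -/

section Cech

variable {S' S : Type u'} [CommRing S'] [CommRing S] {τ : S' →+* S} {e' : S'}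

/-- **Change of local sections changes `θ_αβ` by a coboundary.**  On an overlap thickening with the restricted chart
sections `σˡ, σʳ` and the restrictions `σ'ˡ, σ'ʳ` of other chart sections:
`θ(σ'ˡ, σ'ʳ) = θ(σˡ, σʳ) + θ(σʳ, σ'ʳ) − θ(σˡ, σ'ˡ)`, where `θ(σˡ, σ'ˡ)` is the restriction of `η_α = θ(σ_α, σ'_α)` and
`θ(σʳ, σ'ʳ)` that of `η_β` (`transitionDerivation_naturality`) — so the Čech class of `(θ_αβ)` does not depend on
the chosen trivialisations. [cite: Hartshorne2010, §5 Ex. 5.2 / Thm. 5.3] -/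
theorem transitionDerivation_change_sections (hT' : IsFirstOrderThickening τ e') (σl σr σl' σr' : S →+* S')
    (hl : ∀ a, τ (σl a) = a) (hr : ∀ a, τ (σr a) = a) (hl' : ∀ a, τ (σl' a) = a) (hr' : ∀ a, τ (σr' a) = a) :
    hT'.transitionDerivation σl' σr' hl' hr' =
      hT'.transitionDerivation σl σr hl hr + hT'.transitionDerivation σr σr' hr hr' -
        hT'.transitionDerivation σl σl' hl hl' := by
  rw [hT'.transitionDerivation_cocycle σl' σl σr' hl' hl hr', hT'.transitionDerivation_cocycle σl σr σr' hl hr hr',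
    hT'.transitionDerivation_swap σl σl' hl hl']
  abel

variable {W' W : Type u''} [CommRing W'] [CommRing W] {πW : W' →+* W} {eW : W'}

/-- **The transition derivations form a Čech 1-cocycle of the tangent presheaf.**  Triple-overlap data: a thickening
`π_W : W' ↠ W` with three sections `s_α, s_β, s_γ` (the restricted chart sections) and, for the overlap `αβ`, a morphism
of thickenings `κ` over `k` carrying `σˡ_αβ ↦ s_α`, `σʳ_αβ ↦ s_β`.  Then the restriction of `θ_αβ = θ(σˡ_αβ, σʳ_αβ)`
along `k` is `θ(s_α, s_β)` (naturality), and on `W` the three restricted derivations satisfy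
`θ(s_α, s_γ) = θ(s_α, s_β) + θ(s_β, s_γ)`. [cite: Hartshorne2010, §5 Ex. 5.2 / §6 proof of Thm. 6.2] -/
theorem transitionDerivation_cech_cocycle (hT' : IsFirstOrderThickening τ e') (hW : IsFirstOrderThickening πW eW)
    {κ : S' →+* W'} {k : S →+* W} (hκ : IsThickeningHom τ e' πW eW κ k) (σl σr : S →+* S')
    (hl : ∀ a, τ (σl a) = a) (hr : ∀ a, τ (σr a) = a) (sα sβ sγ : W →+* W') (hα : ∀ a, πW (sα a) = a)
    (hβ : ∀ a, πW (sβ a) = a) (hγ : ∀ a, πW (sγ a) = a) (cl : κ.comp σl = sα.comp k)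
    (cr : κ.comp σr = sβ.comp k) :
    (∀ a, k (hT'.transitionDerivation σl σr hl hr a) = hW.transitionDerivation sα sβ hα hβ (k a)) ∧
      hW.transitionDerivation sα sγ hα hγ =
        hW.transitionDerivation sα sβ hα hβ + hW.transitionDerivation sβ sγ hβ hγ :=
  ⟨transitionDerivation_naturality hT' hW hκ σl σr hl hr sα sβ hα hβ cl cr,
    hW.transitionDerivation_cocycle sα sβ sγ hα hβ hγ⟩

end Cech

/-! ### Every morphism of trivial thickenings is a base change twisted by a derivation along `r` -/

section Trivial

open DualNumber TrivSqZeroExt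

variable {R S : Type u} [CommRing R] [CommRing S] {ρ : R[ε] →+* S[ε]} {r : R →+* S}

/-- **Structure of a morphism of trivial thickenings.**  If `ρ : R[ε] → S[ε]` lies over `r` and fixes `ε`, then with
`δ a := (ρ (inl a)).snd`:  `ρ (a + εb) = r a + ε (r b + δ a)` — `ρ` is the base change `r[ε]` corrected by `δ` (so the
transition maps of ANY atlas of trivialised charts are «`id + ε·derivation`» composed with the restrictions, and the
Kodaira–Spencer data `(θ_αβ)` is intrinsic to the thickened atlas). [cite: Hartshorne2010, §5 Ex. 5.2] -/
theorem IsThickeningHom.dualNumber_apply (h : IsThickeningHom (fstRingHom R) (ε : R[ε]) (fstRingHom S) (ε : S[ε]) ρ r)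
    (z : R[ε]) : ρ z = inl (r z.fst) + ε * inl (r z.snd + (ρ (inl z.fst)).snd) := by
  have hfst : ∀ w : R[ε], (ρ w).fst = r w.fst := fun w ↦ by
    rw [← fstRingHom_apply (ρ w), h.comm, fstRingHom_apply]
  have hρa : ∀ a : R, ρ (inl a) = inl (r a) + ε * inl (ρ (inl a)).snd := fun a ↦ by
    conv_lhs => rw [eq_inl_add_eps_mul_inl (ρ (inl a))]
    rw [hfst, fst_inl]
  conv_lhs => rw [eq_inl_add_eps_mul_inl z, map_add, map_mul, h.map_eps, hρa z.fst, hρa z.snd]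
  have h2 : (ε : S[ε]) * ε = 0 := eps_mul_eps
  rw [inl_add, mul_add]
  linear_combination (inl (ρ (inl z.snd)).snd : S[ε]) * h2

/-- **`δ` is a derivation along `r`**: `δ(ab) = r(a)·δ(b) + r(b)·δ(a)` (compare `ε`-parts of `ρ(inl(ab)) = ρ(inl a)ρ(inl b)`).
[cite: Hartshorne2010, §5 Ex. 5.2] -/
theorem IsThickeningHom.snd_map_inl_mul (h : IsThickeningHom (fstRingHom R) (ε : R[ε]) (fstRingHom S) (ε : S[ε]) ρ r)
    (a b : R) : (ρ (inl (a * b))).snd = r a * (ρ (inl b)).snd + r b * (ρ (inl a)).snd := by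
  have hfst : ∀ w : R[ε], (ρ w).fst = r w.fst := fun w ↦ by
    rw [← fstRingHom_apply (ρ w), h.comm, fstRingHom_apply]
  have hmul : ρ (inl (a * b)) = ρ (inl a) * ρ (inl b) := by rw [← map_mul, inl_mul]
  rw [hmul, DualNumber.snd_mul, hfst, hfst, fst_inl, fst_inl]
  ring

/-- **`δ` is additive** (for any ring map `ρ`). [folklore] -/
theorem snd_map_inl_add (ρ : R[ε] →+* S[ε]) (a b : R) :
    (ρ (inl (a + b))).snd = (ρ (inl a)).snd + (ρ (inl b)).snd := by
  rw [inl_add, map_add, snd_add]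

/-- **The twisted base changes are exactly the morphisms whose `δ` factors through `r`**: `ρ = (twist θ) ∘ r[ε]` on
elements iff `δ = θ ∘ r` — then the transition derivation of the atlas at this overlap is `θ` (`…CechObstructionSplit` /
the twisted atlas). [cite: Hartshorne2010, §5 Ex. 5.2] -/
theorem IsThickeningHom.dualNumber_apply_eq_twist {B : Type u''} [CommRing B] [Algebra B S]
    (h : IsThickeningHom (fstRingHom R) (ε : R[ε]) (fstRingHom S) (ε : S[ε]) ρ r) (θ : Derivation B S S)
    (hδ : ∀ a, (ρ (inl a)).snd = θ (r a)) (z : R[ε]) :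
    ρ z = twist θ (inl (r z.fst) + ε * inl (r z.snd)) := by
  rw [h.dualNumber_apply z, hδ, map_add, map_mul, twist_eps, twist_inl, twist_inl, inl_add]
  have h2 : (ε : S[ε]) * ε = 0 := eps_mul_eps
  linear_combination (-(inl (θ (r z.snd)) : S[ε])) * h2

end Trivial

end EmbeddedDeformation

end Summit.Ventures.HSemireg
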